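import Summits.Ventures.PackingBounds.Configurations.AlgebraicListConfig

/-!
# Minimal polynomial of a field element presented in another generator (kernel checker)

Framing: lottery ticket; floor = certified bounds/negative ranges. Venture `PackingBounds` (cell `pub-packcert`, seat
`pub-packcert-recog`, RECOG.md v42 §30 (f)). Companion to `AlgebraicListConfig.lean`: there a field element is an integer
polynomial `Snum` (low → high) evaluated at a real root `β` of an integer polynomial `Q`, divided by `sden`. When `Q` is MONIC,
the statement "`m = Snum(β)/sden` is a root of the integer polynomial `P`" is decided by a Boolean program over `ℤ`:
`sden ^ deg P · P(Snum/sden) = Σ_i P_i · Snum^i · sden^(deg P − i)` is computed in `ℤ[x]` with every power of `Snum` reduced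
modulo `Q` (`reduceN`: subtract `lead · x^k · Q`, drop the vanished top coefficient) and must be the zero list (`composeModOK`).
Soundness (`comp_root`): `Q(β) = 0`, `composeModOK = true`, `sden ≠ 0` ⇒ `P(Snum(β)/sden) = 0`. The reduction is sound for ANY
`Q` (each step subtracts a multiple of `Q` and drops a top coefficient only when it is `0`); monicity is what makes it terminate
usefully. Use: the §30 re-encoded objects (`TammesN30Deg29`, …) state their bound as `Snum(β)/sden` in a reduced generator β;
this file lets the cover restate the bound as a root of the maximal cosine's own minimal polynomial (RECOG.md §28/§29).
-/

namespace Summit.Ventures.PackingBounds.Config.AlgWeighted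

/-- Drop the last coefficient if it is `0` (value-preserving). -/
def dropLastZero : List ℤ → List ℤ
  | [] => []
  | [a] => if a = 0 then [] else [a]
  | a :: b :: t => a :: dropLastZero (b :: t)

/-- One reduction step modulo `Q` of degree `d`: if `f` is longer than `d`, subtract `lead(f) · x^(len f − 1 − d) · Q` and drop
the top coefficient when it vanished. -/
def reduceStep (Q : List ℤ) (d : ℕ) (f : List ℤ) : List ℤ :=
  if f.length ≤ d then f else dropLastZero (lsub f (lsmul (f.getLast?.getD 0) (List.replicate (f.length - 1 - d) 0 ++ Q)))

/-- `n` reduction steps. -/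
def reduceN (Q : List ℤ) (d : ℕ) : ℕ → List ℤ → List ℤ
  | 0, f => f
  | n + 1, f => reduceN Q d n (reduceStep Q d f)

/-- Reduce `f` modulo `Q` (fuel = length of `f`). -/
def reduceQ (Q : List ℤ) (f : List ℤ) : List ℤ := reduceN Q (Q.length - 1) f.length f

/-- `Σ_i P_i · pw · Snum^i · sden^(dP − j − i)` with reduced powers: `P` low → high, `pw ≡ Snum^j (mod Q)`. -/
def compAux (Q Snum : List ℤ) (sden : ℕ) (dP : ℕ) : List ℤ → List ℤ → ℕ → List ℤ
  | [], _, _ => []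
  | p :: rest, pw, j => ladd (lsmul (p * (sden : ℤ) ^ (dP - j)) pw) (compAux Q Snum sden dP rest (reduceQ Q (lmul pw Snum)) (j + 1))

/-- Kernel check: `Σ_i P_i · Snum^i · sden^(deg P − i) ≡ 0 (mod Q)` — the reduced representative is the zero list. -/
def composeModOK (P Snum : List ℤ) (sden : ℕ) (Q : List ℤ) : Bool :=
  lzero (compAux Q Snum sden (P.length - 1) P [1] 0)

/-- `leval` of a snoc. -/
theorem leval_append_singleton (x : ℝ) (l : List ℤ) (c : ℤ) :
    leval x (l ++ [c]) = leval x l + c * x ^ l.length := by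
  induction l with
  | nil => simp [leval]
  | cons a t ih => simp [leval, ih]; ring

/-- `dropLastZero` preserves the value. -/
theorem leval_dropLastZero (x : ℝ) : ∀ l : List ℤ, leval x (dropLastZero l) = leval x l
  | [] => rfl
  | [a] => by
      unfold dropLastZero
      split_ifs with h
      · simp [leval, h]
      · rfl
  | a :: b :: t => by
      have ih := leval_dropLastZero x (b :: t)
      rw [dropLastZero, leval_cons, leval_cons, ih]

/-- `leval` of `replicate k 0 ++ Q` is `x^k · Q(x)`. -/
theorem leval_replicate_append (x : ℝ) (k : ℕ) (Q : List ℤ) :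
    leval x (List.replicate k 0 ++ Q) = x ^ k * leval x Q := by
  induction k with
  | zero => simp
  | succ k ih => rw [List.replicate_succ, List.cons_append, leval_cons, ih]; push_cast; ring

/-- A reduction step preserves the value at a root of `Q`. -/
theorem leval_reduceStep {x : ℝ} {Q : List ℤ} (hQ : leval x Q = 0) (d : ℕ) (f : List ℤ) :
    leval x (reduceStep Q d f) = leval x f := by
  unfold reduceStep
  split_ifs
  · rfl
  · rw [leval_dropLastZero, leval_lsub, leval_lsmul, leval_replicate_append, hQ]; ring

/-- `reduceN` preserves the value at a root of `Q`. -/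
theorem leval_reduceN {x : ℝ} {Q : List ℤ} (hQ : leval x Q = 0) (d : ℕ) :
    ∀ (n : ℕ) (f : List ℤ), leval x (reduceN Q d n f) = leval x f
  | 0, f => rfl
  | n + 1, f => by rw [reduceN, leval_reduceN hQ d n, leval_reduceStep hQ]

/-- `reduceQ` preserves the value at a root of `Q`. -/
theorem leval_reduceQ {x : ℝ} {Q : List ℤ} (hQ : leval x Q = 0) (f : List ℤ) :
    leval x (reduceQ Q f) = leval x f := leval_reduceN hQ _ _ _

/-- Value of `compAux`: with `pw(x) = w`, `compAux P pw j` evaluates to `Σ_i P_i · w · S^i · sden^(dP − j − i)` written as a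
Horner-free closed form `w · H` where `H` satisfies the recursion below; we state the consequence we need directly:
`leval x (compAux P pw j) = leval x pw * F j P` where `F j (p :: rest) = p · sden^(dP−j) + S · F (j+1) rest`. -/
noncomputable def F (S : ℝ) (sden : ℕ) (dP : ℕ) : ℕ → List ℤ → ℝ
  | _, [] => 0
  | j, p :: rest => p * (sden : ℝ) ^ (dP - j) + S * F S sden dP (j + 1) rest

/-- Evaluation of `compAux` at a root of `Q`. -/
theorem leval_compAux {x : ℝ} {Q : List ℤ} (hQ : leval x Q = 0) (Snum : List ℤ) (sden : ℕ) (dP : ℕ) :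
    ∀ (P pw : List ℤ) (j : ℕ),
      leval x (compAux Q Snum sden dP P pw j) = leval x pw * F (leval x Snum) sden dP j P
  | [], pw, j => by simp [compAux, F]
  | p :: rest, pw, j => by
      rw [compAux, leval_ladd, leval_lsmul, leval_compAux hQ Snum sden dP rest, leval_reduceQ hQ, leval_lmul, F]
      push_cast; ring

/-- `F 0 P` at `S` is the homogenised evaluation: for `sden ≠ 0` and `dP + 1 = P.length`… we only need the clean identity
`F j P · sden^j = sden^dP' · leval (S/sden) P` when `dP' = dP` and `j + P.length = dP + 1`; stated for general `j`. -/
theorem F_eq {S : ℝ} {sden : ℕ} (hs : (sden : ℝ) ≠ 0) (dP : ℕ) :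
    ∀ (P : List ℤ) (j : ℕ), j + P.length = dP + 1 →
      F S sden dP j P * (sden : ℝ) ^ j = (sden : ℝ) ^ dP * leval (S / sden) P
  | [], j, _ => by simp [F]
  | p :: rest, j, h => by
      have h' : (j + 1) + rest.length = dP + 1 := by simp [List.length] at h ⊢; omega
      have ih := F_eq (S := S) hs dP rest (j + 1) h'
      have hj : j ≤ dP := by simp [List.length] at h; omega
      rw [F, leval_cons]
      have e1 : (sden : ℝ) ^ dP = (sden : ℝ) ^ (dP - j) * (sden : ℝ) ^ j := by
        rw [← pow_add, Nat.sub_add_cancel hj]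
      have e2 : (sden : ℝ) ^ (j + 1) = (sden : ℝ) ^ j * sden := pow_succ _ _
      rw [e2] at ih
      have : S * F S sden dP (j + 1) rest * (sden : ℝ) ^ j
          = (S / sden) * ((sden : ℝ) ^ dP * leval (S / sden) rest) := by
        rw [← ih]; field_simp
      calc (↑p * (sden : ℝ) ^ (dP - j) + S * F S sden dP (j + 1) rest) * (sden : ℝ) ^ j
          = ↑p * ((sden : ℝ) ^ (dP - j) * (sden : ℝ) ^ j) + S * F S sden dP (j + 1) rest * (sden : ℝ) ^ j := by ring
        _ = ↑p * (sden : ℝ) ^ dP + (S / sden) * ((sden : ℝ) ^ dP * leval (S / sden) rest) := by rw [← e1, this]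
        _ = (sden : ℝ) ^ dP * (↑p + S / ↑sden * leval (S / ↑sden) rest) := by ring

/-- **Soundness.** If `β` is a root of `Q`, the composition check passes and `sden ≠ 0`, then `m = Snum(β)/sden` is a root
of `P`: `leval m P = 0`. -/
theorem comp_root {β : ℝ} {Q P Snum : List ℤ} {sden : ℕ} (hQ : leval β Q = 0) (hs : sden ≠ 0) (hP : P ≠ [])
    (h : composeModOK P Snum sden Q = true) : leval (leval β Snum / sden) P = 0 := by
  have hsr : (sden : ℝ) ≠ 0 := by exact_mod_cast hs
  have hz := leval_of_lzero β h
  rw [leval_compAux hQ, leval_cons, leval_nil] at hz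
  simp only [Int.cast_one, mul_zero, add_zero, one_mul] at hz
  have hlen : 0 + P.length = (P.length - 1) + 1 := by
    have : 0 < P.length := List.length_pos_of_ne_nil hP
    omega
  have key := F_eq (S := leval β Snum) hsr (P.length - 1) P 0 hlen
  rw [hz, pow_zero, mul_one] at key
  have hpow : (sden : ℝ) ^ (P.length - 1) ≠ 0 := pow_ne_zero _ hsr
  exact (mul_eq_zero.1 key.symm).resolve_left hpow

end Summit.Ventures.PackingBounds.Config.AlgWeighted
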